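import Summits.QuantumFields.GaugeBoot.BootstrapCovarianceGroup
import Summits.QuantumFields.GaugeBoot.BootstrapReflectionCutLevels
import Summits.QuantumFields.GaugeBoot.StrongCouplingOrderPlaquette
import HarnessLib

/-!
# The full hyperoctahedral group of the torus costs at most two levels for the mean plaquette (gauge-boot, L1/L4 supplement)

HONEST FRAMING (cell `pub-gaugeboot`, page 1 of every file): the venture produces certified bounds
on lattice expectations at stated coupling, gauge group, dimension and torus size; NOT a mass gap,
NOT a continuum limit, NOT a string tension; NOT Yang–Mills-summit-bearing (barriers
`FixedCouplingUltralocality`, `PerturbativeInvisibility`). Structural; it certifies no number.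

## Content (`SU(N)` Wilson theory on the torus `(ℤ/L)^d`, `d, L ≥ 1`, any real `β`, word level `n`)

The venture's certified object is the TORUS-AVERAGED PLAQUETTE `meanPlaquetteCM` (SCOPING A2), and
the SDPs it certifies identify Wilson loops related by the full lattice symmetry group
`B_d ⋉ (ℤ/L)^d` (translations, axis permutations, reflections). `BootstrapSymmetryReduction` showed
the orientation-preserving part is lossless at every level; `BootstrapReflectionCutLevels` showed
ONE reflection costs at most two levels. Here the whole group at once, via the covariance group of
`BootstrapCovarianceGroup`:

* `reflEdgeEquiv`, `revMap_translate/_edgePerm/_reflEdge` — the three generator families of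
  `B_d ⋉ (ℤ/L)^d` are link-reversing relabellings; `translate/edgePerm/reflEdge_mem_covPairs` — they
  lie in the covariance group of the Wilson action; `torusFullSymmetryMaps` (the generating family
  used by `isSDFunctional_comp_latticeSymmetry_suN`);
* ★★★ `levelValues_succ_succ_subset_fullTorusSym_suN` — for every objective `P` invariant under the
  covariance group (e.g. every function of the Wilson action, `comp_revMap_eq_of_wilsonActionDetermined`):
  `levelValues_{n+2}(P) ⊆ symLevelValues_n(B_d ⋉ (ℤ/L)^d, P) ⊆ levelValues_n(P)`;
* `meanPlaquette_eq_of_wilsonAction` (`ū_P = (#P)⁻¹ N⁻¹ (N·#P - S_W)`); ★★★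
  `fullTorusSym_sandwich_meanPlaquette_suN` — THE MEAN PLAQUETTE: imposing the full hyperoctahedral
  symmetry on the level-`n` SDP gains at most what two more units of word length gain; same for the
  Wilson action itself (`fullTorusSym_sandwich_wilsonAction_suN`); `csSup` form.

What this is NOT: whether the reflections gain anything at a fixed level; reflection POSITIVITY cuts
(genuine, `BootstrapRPCutDensity`); `U(N)`; rates.

References: V. Kazakov, Z. Zheng, arXiv:2203.11360 §3.2–3.3; P. Anderson, M. Kruczenski, Nucl. Phys.
B 921 (2017) §3; K. Gatermann, P. A. Parrilo, J. Pure Appl. Algebra 192 (2004) 95, Thm 3.3. Folklore.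
-/

noncomputable section

open MeasureTheory Filter Topology NormedSpace
open Literature.MathematicalPhysics.QuantumFieldTheory (LatticeRep Site Edge GaugeConfig Plaquette
  plaquetteHolonomy wilsonAction edgePerm wilsonAction_negReflect_eq)
open Literature.MathematicalPhysics.QuantumLattice

namespace Summit.QuantumFields.GaugeBoot

/-! ## The generators of `B_d ⋉ (ℤ/L)^d` as covariant link-reversing relabellings -/

section Generators

variable {d L : ℕ} {G : Type*} [Group G] [TopologicalSpace G] [IsTopologicalGroup G]

/-- A translation is the pair `(translateEquiv a, no reversed link)`. -/
theorem revMap_translate (a : Site d L) :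
    revMap (G := G) ((translateEquiv a, fun _ => false) : (Edge d L ≃ Edge d L) × (Edge d L → Bool)) =
      relabelCM (G := G) (translateEquiv a) :=
  revMap_of_forall_false _

/-- An axis permutation is the pair `(edgePerm σ, no reversed link)`. -/
theorem revMap_edgePerm (σ : Equiv.Perm (Fin d)) :
    revMap (G := G) ((edgePerm (L := L) σ, fun _ => false) : (Edge d L ≃ Edge d L) × (Edge d L → Bool)) =
      relabelCM (G := G) (edgePerm (L := L) σ) :=
  revMap_of_forall_false _

variable [NeZero d]

omit [TopologicalSpace G] [IsTopologicalGroup G] in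
/-- `reflEdge` (the link read by the site reflection `Θ'`) as a bijection of the links. -/
def reflEdgeEquiv : Edge d L ≃ Edge d L where
  toFun := reflEdge
  invFun := reflEdge
  left_inv := reflEdge_reflEdge
  right_inv := reflEdge_reflEdge

omit [Group G] [TopologicalSpace G] [IsTopologicalGroup G] in
/-- `reflEdgeEquiv` evaluated. -/
@[simp] theorem reflEdgeEquiv_apply (e : Edge d L) : reflEdgeEquiv (d := d) (L := L) e = reflEdge e := rfl

/-- ★ The site reflection `Θ'` is the pair `(reflEdge, the links along the axis 0)`. -/
theorem revMap_reflEdge :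
    revMap (G := G) ((reflEdgeEquiv, fun e => decide (e.2 = 0)) : (Edge d L ≃ Edge d L) × (Edge d L → Bool)) =
      negReflectCM (G := G) (d := d) (L := L) := by
  ext U e
  rw [revMap_apply, negReflectCM_apply, negReflect_apply_eq]
  simp only [reflEdgeEquiv_apply, decide_eq_true_eq]

variable [NeZero L]
variable {N : ℕ} (ρ : G →* Matrix (Fin N) (Fin N) ℂ)

omit [NeZero d] in
/-- Translations lie in the covariance group of the Wilson action. -/
theorem translate_mem_covPairs (a : Site d L) :
    ((translateEquiv a, fun _ => false) : (Edge d L ≃ Edge d L) × (Edge d L → Bool)) ∈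
      covPairs (G := G) (fun _ : Edge d L => wilsonAction ρ) := by
  intro e U
  rw [revMap_translate]
  exact wilsonAction_comp_translateEquiv ρ a U

omit [NeZero d] in
/-- Axis permutations lie in the covariance group of the Wilson action. -/
theorem edgePerm_mem_covPairs [CompactSpace G] [MeasurableSpace G] (hρ : Continuous ρ) (σ : Equiv.Perm (Fin d)) :
    ((edgePerm (L := L) σ, fun _ => false) : (Edge d L ≃ Edge d L) × (Edge d L → Bool)) ∈
      covPairs (G := G) (fun _ : Edge d L => wilsonAction ρ) := by
  intro e U
  rw [revMap_edgePerm]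
  exact wilsonAction_comp_edgePerm ρ hρ σ U

/-- ★ The site reflection lies in the covariance group of the Wilson action. -/
theorem reflEdge_mem_covPairs [CompactSpace G] (hρ : Continuous ρ) :
    ((reflEdgeEquiv, fun e => decide (e.2 = 0)) : (Edge d L ≃ Edge d L) × (Edge d L → Bool)) ∈
      covPairs (G := G) (fun _ : Edge d L => wilsonAction ρ) := by
  intro e U
  rw [revMap_reflEdge, negReflectCM_apply]
  exact wilsonAction_negReflect_eq ρ hρ U

/-- ★★ **Functions of the Wilson action are invariant under the whole covariance group** (e.g. the
mean plaquette, the action itself). -/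
theorem comp_revMap_eq_of_wilsonActionDetermined {P : C(GaugeConfig d L G, ℝ)}
    (hP : ∀ U V, wilsonAction ρ U = wilsonAction ρ V → P U = P V)
    {p : (Edge d L ≃ Edge d L) × (Edge d L → Bool)}
    (hp : p ∈ covPairs (G := G) (fun _ : Edge d L => wilsonAction ρ)) : P.comp (revMap (G := G) p) = P := by
  ext U
  exact hP _ _ (hp ((fun _ => 0, 0) : Edge d L) U)

end Generators

/-! ## The mean plaquette is a function of the Wilson action -/

section MeanPlaquette

variable {d L : ℕ} [NeZero L] {G : Type*} [Group G] {N : ℕ} (ρ : G →* Matrix (Fin N) (Fin N) ℂ)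

/-- `ū_P = (#P)⁻¹ N⁻¹ (N · #P - S_W)` (an identity of real numbers, junk-free for `N = 0` or no
plaquettes thanks to `0⁻¹ = 0`). -/
theorem meanPlaquette_eq_of_wilsonAction (U : GaugeConfig d L G) :
    meanPlaquette ρ U = (Fintype.card (Plaquette d L) : ℝ)⁻¹ * ((N : ℝ)⁻¹ *
      ((N : ℝ) * Fintype.card (Plaquette d L) - wilsonAction ρ U)) := by
  unfold meanPlaquette plaquetteTrace wilsonAction
  rw [Finset.sum_sub_distrib, Finset.sum_const, Finset.card_univ, nsmul_eq_mul, ← Finset.mul_sum]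
  ring

/-- **The mean plaquette depends on the configuration only through the Wilson action.** -/
theorem meanPlaquette_eq_of_wilsonAction_eq {U V : GaugeConfig d L G}
    (h : wilsonAction ρ U = wilsonAction ρ V) : meanPlaquette ρ U = meanPlaquette ρ V := by
  rw [meanPlaquette_eq_of_wilsonAction, meanPlaquette_eq_of_wilsonAction, h]

end MeanPlaquette

/-! ## `SU(N)`: the sandwich for the full symmetry group of the torus -/

section SuN

variable {d L : ℕ} [NeZero d] [NeZero L] (N : ℕ) (β : ℝ) (n : ℕ)

/-- **The generating family of `B_d ⋉ (ℤ/L)^d`** on `SU(N)` configurations: all translations, all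
axis permutations, the site reflection (the family of `isSDFunctional_comp_latticeSymmetry_suN`). -/
def torusFullSymmetryMaps (d L N : ℕ) [NeZero d] :
    Set C(GaugeConfig d L (Matrix.specialUnitaryGroup (Fin N) ℂ), GaugeConfig d L (Matrix.specialUnitaryGroup (Fin N) ℂ)) :=
  (Set.range fun a : Site d L => relabelCM (G := Matrix.specialUnitaryGroup (Fin N) ℂ) (translateEquiv a)) ∪
      (Set.range fun σ : Equiv.Perm (Fin d) =>
        relabelCM (G := Matrix.specialUnitaryGroup (Fin N) ℂ) (edgePerm (L := L) σ)) ∪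
    {negReflectCM}

/-- ★★★ **The full symmetry group of the torus costs at most two levels.** `SU(N)`, any `β`, any
objective `P` invariant under the covariance group of the Wilson action (e.g. any function of the
action): every level-`(n+2)` feasible value of `P` is a value of a level-`n` feasible functional
invariant (on the level-`n` test functions — indeed on all observables) under all translations, all
axis permutations and the site reflection, hence under the whole of `B_d ⋉ (ℤ/L)^d`. [folklore] -/
theorem levelValues_succ_succ_subset_fullTorusSym_suN
    {P : C(GaugeConfig d L (Matrix.specialUnitaryGroup (Fin N) ℂ), ℝ)}
    (hP : ∀ p ∈ covPairs (G := Matrix.specialUnitaryGroup (Fin N) ℂ)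
        (fun _ : Edge d L => wilsonAction (fundamentalRep (Fin N))),
      P.comp (revMap (G := Matrix.specialUnitaryGroup (Fin N) ℂ) p) = P) :
    levelValuesSuN (d := d) (L := L) N β (n + 2) P ⊆
      symLevelValuesSuN (d := d) (L := L) N β n (torusFullSymmetryMaps d L N) P := by
  rintro t ⟨φ, hφ, rfl⟩
  obtain ⟨ψ, hψ, hinv, hval⟩ := exists_covGroupInvariant_feasible_suN (ι := Edge d L) N
    (fun _ => wilsonAction_mem_polyFunctions (fundamentalLatticeRep N)) hφ
  refine ⟨ψ, hψ, ?_, hval P hP⟩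
  rintro R ((⟨a, rfl⟩ | ⟨σ, rfl⟩) | hR) v -
  · dsimp only
    rw [← revMap_translate]
    exact hinv _ (translate_mem_covPairs (fundamentalRep (Fin N)) a) v
  · dsimp only
    rw [← revMap_edgePerm]
    exact hinv _ (edgePerm_mem_covPairs (fundamentalRep (Fin N)) (continuous_fundamentalRep _) σ) v
  · rw [Set.mem_singleton_iff.1 hR, ← revMap_reflEdge]
    exact hinv _ (reflEdge_mem_covPairs (fundamentalRep (Fin N)) (continuous_fundamentalRep _)) v

/-- ★★★ **The sandwich for covariance-invariant objectives**:
`levelValues_{n+2}(P) ⊆ symLevelValues_n(B_d ⋉ (ℤ/L)^d, P) ⊆ levelValues_n(P)`. -/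
theorem fullTorusSym_sandwich_suN
    {P : C(GaugeConfig d L (Matrix.specialUnitaryGroup (Fin N) ℂ), ℝ)}
    (hP : ∀ p ∈ covPairs (G := Matrix.specialUnitaryGroup (Fin N) ℂ)
        (fun _ : Edge d L => wilsonAction (fundamentalRep (Fin N))),
      P.comp (revMap (G := Matrix.specialUnitaryGroup (Fin N) ℂ) p) = P) :
    levelValuesSuN (d := d) (L := L) N β (n + 2) P ⊆
        symLevelValuesSuN (d := d) (L := L) N β n (torusFullSymmetryMaps d L N) P ∧
      symLevelValuesSuN (d := d) (L := L) N β n (torusFullSymmetryMaps d L N) P ⊆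
        levelValuesSuN (d := d) (L := L) N β n P :=
  ⟨levelValues_succ_succ_subset_fullTorusSym_suN N β n hP, symLevelValues_subset_levelValues N β n _ P⟩

/-- ★★★ **THE MEAN PLAQUETTE** (the venture's certified object): imposing the full hyperoctahedral
symmetry of the torus on the level-`n` `SU(N)` bootstrap for `ū_P` gains at most what two more units
of word length gain: `levelValues_{n+2}(ū_P) ⊆ fullSym_n(ū_P) ⊆ levelValues_n(ū_P)`. [folklore] -/
theorem fullTorusSym_sandwich_meanPlaquette_suN :
    levelValuesSuN (d := d) (L := L) N β (n + 2) (meanPlaquetteCM (fundamentalLatticeRep N)) ⊆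
        symLevelValuesSuN (d := d) (L := L) N β n (torusFullSymmetryMaps d L N)
          (meanPlaquetteCM (fundamentalLatticeRep N)) ∧
      symLevelValuesSuN (d := d) (L := L) N β n (torusFullSymmetryMaps d L N)
          (meanPlaquetteCM (fundamentalLatticeRep N)) ⊆
        levelValuesSuN (d := d) (L := L) N β n (meanPlaquetteCM (fundamentalLatticeRep N)) :=
  fullTorusSym_sandwich_suN N β n fun _ hp =>
    comp_revMap_eq_of_wilsonActionDetermined (fundamentalRep (Fin N)) (fun U V h => by
      rw [coe_meanPlaquetteCM]
      exact meanPlaquette_eq_of_wilsonAction_eq (fundamentalRep (Fin N)) h) hp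

/-- ★★ **The Wilson action itself**: the same sandwich. -/
theorem fullTorusSym_sandwich_wilsonAction_suN :
    levelValuesSuN (d := d) (L := L) N β (n + 2) (wilsonActionCM (fundamentalLatticeRep N)) ⊆
        symLevelValuesSuN (d := d) (L := L) N β n (torusFullSymmetryMaps d L N)
          (wilsonActionCM (fundamentalLatticeRep N)) ∧
      symLevelValuesSuN (d := d) (L := L) N β n (torusFullSymmetryMaps d L N)
          (wilsonActionCM (fundamentalLatticeRep N)) ⊆
        levelValuesSuN (d := d) (L := L) N β n (wilsonActionCM (fundamentalLatticeRep N)) :=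
  fullTorusSym_sandwich_suN N β n fun _ hp =>
    comp_revMap_eq_of_wilsonActionDetermined (fundamentalRep (Fin N)) (fun U V h => by
      rw [coe_wilsonActionCM]; exact h) hp

/-- **Bounds form** for the mean plaquette (where the plain level-`n` values are bounded above and
the level-`(n+2)` values non-empty): `hi_{n+2}(ū_P) ≤ hi^{full}_n(ū_P) ≤ hi_n(ū_P)`. -/
theorem csSup_fullTorusSym_sandwich_meanPlaquette_suN
    (hbdd : BddAbove (levelValuesSuN (d := d) (L := L) N β n (meanPlaquetteCM (fundamentalLatticeRep N))))
    (hne : (levelValuesSuN (d := d) (L := L) N β (n + 2) (meanPlaquetteCM (fundamentalLatticeRep N))).Nonempty) :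
    sSup (levelValuesSuN (d := d) (L := L) N β (n + 2) (meanPlaquetteCM (fundamentalLatticeRep N))) ≤
        sSup (symLevelValuesSuN (d := d) (L := L) N β n (torusFullSymmetryMaps d L N)
          (meanPlaquetteCM (fundamentalLatticeRep N))) ∧
      sSup (symLevelValuesSuN (d := d) (L := L) N β n (torusFullSymmetryMaps d L N)
          (meanPlaquetteCM (fundamentalLatticeRep N))) ≤
        sSup (levelValuesSuN (d := d) (L := L) N β n (meanPlaquetteCM (fundamentalLatticeRep N))) := by
  obtain ⟨h1, h2⟩ := fullTorusSym_sandwich_meanPlaquette_suN (d := d) (L := L) N β n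
  exact ⟨csSup_le_csSup (hbdd.mono h2) hne h1, csSup_le_csSup hbdd (hne.mono h1) h2⟩

end SuN

end Summit.QuantumFields.GaugeBoot

end
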